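import Literature.NumberTheory.Automorphic.SymplecticSimilitudeIwasawa
import Literature.NumberTheory.Automorphic.SymplecticSimilitudeHyperspecialCompactOpen
import Literature.NumberTheory.Automorphic.SymplecticSatakeTransform
import HarnessLib

/-!
# The Satake transform of the spherical Hecke algebra `ℋ(GSp_{2n}(K), GSp_{2n}(𝒪))` as an algebra homomorphism to
# `R[ℤⁿ × ℤ]` (Andrianov–Zhuravlev's spherical map `Ω` of the Hecke ring of `GSp_n`, abstract form)

Topic `NumberTheory/Automorphic`; namespace `Literature.NumberTheory.Automorphic.SymplecticCartan` (lane `lit-hodgefound`,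
Track 2 foundations; seat `lit-hodgefound-p11`, generation 37, row g37-#7).  Definitions with bodies (`similitudeSatakeWeight`,
`similitudeSatakeTransform`, `similitudeHeckeEigencharacter`) + theorems; no named fact, no instance, no notation.  Assembles
`SymplecticSimilitudeIwasawa` (`GSp(J, K) = B(K) · GSp(J, 𝒪)`, exponents `similitudeIwasawaExp = (a, c) ∈ ℤⁿ × ℤ`),
`SymplecticSatakeTransform` (the weight `q^{⟨ρ, a⟩}`, `ρ = (n, …, 1)`) and the abstract `SatakeTransformIwasawa`.

## The print

[AndrianovZhuravlev1995] Ch. 3 §3.3 (3.44)–(3.49) and Thm. 3.30 (held text pp. 147–149): the spherical map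
`Ω = Ω_p^n : L_{0,p}^n → ℚ[x₀^{±1}, …, x_n^{±1}]` of the Hecke ring of `GSp_n(ℚ_p)` relative to `GSp_n(ℤ_p)` — a double coset is
expanded into left cosets `Γ₀ M` with triangular representatives `M = (r D* B; 0 D)`, `D = (d_{ij})` upper triangular with
`dᵢᵢ = p^{δᵢ}`, and sent to `x₀^{δ} Π xᵢ^{δᵢ}` times a power of `p` (the «`-⟨i⟩`»/`p^{…}` normalisation of (3.46)–(3.49)); it
is a ring homomorphism, and (Thm. 3.30, not claimed here) an isomorphism onto the `W`-invariants.  [CartierCorvallis1979] §IV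
(4.2), Thm. 4.1 (`Sf(m) = δ(m)^{1/2} ∫_N f(mn) dn` is an algebra homomorphism; for `G = GSp_{2n}`, `K` hyperspecial);
[Kottwitz1992] §7 (Case C: `X_*(S) ≅ ℤ × ℤⁿ`).  NORMALISATION: for the Borel `B(K)` of `SymplecticSimilitudeIwasawa` with torus
`diag(t_inl; t_inr)`, `t_{inl i} t_{inr i} = r`, and coordinates `aᵢ = ord t_{inl i}`, `c = ord r`, the modulus is
`δ_B = q^{2⟨ρ, a⟩ - c·n(n+1)/2}`; the weight used here is **`w(a, c) = q^{⟨ρ, a⟩} = δ_B^{1/2} · |r|^{-n(n+1)/4}`**, Cartier's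
`δ^{1/2}` twisted by the unramified character `|r(g)|^{-n(n+1)/4}` of `GSp` so that all weights are INTEGRAL powers of `q`
(exactly as the tree's `GL_n` transform uses `δ^{1/2}|det|^{(n-1)/2}`, `SatakeTransformGL`); by `satakeTransform_eq_monomialTwist_comp`
any other normalisation is a monomial twist of this one.  Example `n = 1` (`GSp₂ = GL₂`, basis order `(inr, inl)`):
`δ^{1/2}(p) = q^{a - c/2}`, `w = q^{a}`.

## What is formalised (`K` a field with `Valued K ℤᵐ⁰`, uniformiser `ϖ`, `n ≠ 0`; `R` a commutative ring, `q ∈ Rˣ`)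

* `isHeckeTriple_symplecticSimilitudeInt` (`𝒪` compact ⇒ a Hecke pair); **`isIwasawaExponent_similitude`** — `similitudeIwasawaExp hϖ`
  is an Iwasawa exponent for `(B(K), GSp(J, 𝒪))`.
* **`similitudeSatakeWeight q : Multiplicative (ℤⁿ × ℤ) →* R`**, `(a, c) ↦ q^{⟨ρ, a⟩}` (`similitudeSatakeWeight_ofAdd`).
* **`similitudeSatakeTransform hϖ q : ℋ(GSp(J, K), GSp(J, 𝒪)) →ₐ[R] R[ℤⁿ × ℤ]`** — AN ALGEBRA HOMOMORPHISM;
  `similitudeSatakeTransform_doubleCosetOperator` (`𝒮(T_g) = Σ_{α ∈ K₀gK₀/K₀} q^{⟨ρ, a(α)⟩} x^{(a, c)(α)}`),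
  `coeff_similitudeSatakeTransform_doubleCosetOperator`, `similitudeSatakeTransform_eq_monomialTwist_comp`.
* **`similitudeHeckeEigencharacter hϖ q χ : ℋ →ₐ[R] R`**, `similitudeHeckeEigencharacter_doubleCosetOperator`, `_eq_one_mul`,
  and the degree `similitudeHeckeEigencharacter_one_one_doubleCosetOperator = #(K₀gK₀/K₀)`.

## References
* [AndrianovZhuravlev1995] A. N. Andrianov, V. G. Zhuravlev, *Modular Forms and Hecke Operators*, Transl. Math. Monogr. 145
  (1995), Ch. 3 §3.3 (3.44)–(3.49), Thm. 3.30.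
* [CartierCorvallis1979] P. Cartier, *Representations of 𝔭-adic groups: a survey*, PSPM 33.1 (1979), §IV (4.2), Thm. 4.1.
* [Kottwitz1992] R. E. Kottwitz, *Points on some Shimura varieties over finite fields*, J. AMS 5 (1992), §7.
* [GetzHahn2024] J. R. Getz, H. Hahn, *An Introduction to Automorphic Representations*, GTM 300 (2024), §7.5 (7.17), Lemma 7.5.3.
-/

noncomputable section

open scoped Valued WithZero MatrixGroups
open Matrix MonoidAlgebra Representation Finset

namespace Literature.NumberTheory.Automorphic.SymplecticCartan

open Literature.NumberTheory.Automorphic.HermitianLattice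

variable {K : Type*} [Field K] {n : ℕ}

/-! ## §1 The Hecke pair and the Iwasawa datum of `GSp(J, K)` -/

section Valued

variable [Valued K ℤᵐ⁰] {ϖ : K}

/-- **`(GSp(J, K), GSp(J, 𝒪))` is a Hecke pair** when `𝒪` is compact (`GSp(J, 𝒪)` compact open; the tree's
`isHeckeTriple_top_of_isCompact_isOpen`). [cite: AndrianovZhuravlev1995, Ch. 3 §1 Lemma 1.5, §3 Lemma 3.4] -/
theorem isHeckeTriple_symplecticSimilitudeInt [CompactSpace 𝒪[K]] {l : Type*} [Fintype l] [DecidableEq l] :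
    IsHeckeTriple (⊤ : Submonoid (symplecticSimilitudeGroup l K)) (symplecticSimilitudeInt l K) (symplecticSimilitudeInt l K) :=
  isHeckeTriple_top_of_isCompact_isOpen _ isCompact_symplecticSimilitudeInt isOpen_symplecticSimilitudeInt

variable [NeZero n]

/-- **The Iwasawa datum of the group of symplectic similitudes**: `similitudeIwasawaExp hϖ : GSp(J, K) → ℤⁿ × ℤ` is an Iwasawa
exponent for `(B(K), GSp(J, 𝒪))`. [cite: CartierCorvallis1979, §IV (4.2); Kottwitz1992, §7] -/
theorem isIwasawaExponent_similitude (hϖ : Valued.v ϖ = WithZero.exp (-1 : ℤ)) :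
    IsIwasawaExponent (symplecticSimilitudeBorel n K) (symplecticSimilitudeInt (Fin n) K) (similitudeIwasawaExp hϖ) where
  mul_of_mem_right g _ hk := similitudeIwasawaExp_mul_of_mem_symplecticSimilitudeInt hϖ g hk
  mul_of_mem_left hp g := similitudeIwasawaExp_mul_of_mem_symplecticSimilitudeBorel hϖ hp g
  exists_eq_mul g := by
    obtain ⟨p, k, hp, hk, h⟩ := exists_mem_symplecticSimilitudeBorel_mul_symplecticSimilitudeInt hϖ g
    exact ⟨p, hp, k, hk, h⟩

end Valued

/-! ## §2 The weight `(a, c) ↦ q^{⟨ρ, a⟩}` -/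

variable {R : Type*} [CommRing R]

/-- **The Satake weight of `GSp_{2n}`**: `(a, c) ↦ q^{⟨ρ, a⟩}` (`ρ = (n, …, 1)`; `= δ_B^{1/2} |r|^{-n(n+1)/4}`, the integral
normalisation), as a homomorphism `Multiplicative (ℤⁿ × ℤ) →* R` for a unit `q`. [cite: CartierCorvallis1979, §IV (4.2)]
[cite: AndrianovZhuravlev1995, Ch. 3 §3.3 (3.46)–(3.49)] -/
def similitudeSatakeWeight (q : Rˣ) : Multiplicative ((Fin n → ℤ) × ℤ) →* R :=
  (symplecticSatakeWeight q).comp (AddMonoidHom.toMultiplicative (AddMonoidHom.fst (Fin n → ℤ) ℤ))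

/-- `similitudeSatakeWeight q (a, c) = q^{⟨ρ, a⟩}`. [cite: CartierCorvallis1979, §IV (4.2)] -/
theorem similitudeSatakeWeight_ofAdd (q : Rˣ) (ac : (Fin n → ℤ) × ℤ) :
    similitudeSatakeWeight q (Multiplicative.ofAdd ac) = ((q ^ symplecticRhoPairing ac.1 : Rˣ) : R) := by
  rw [similitudeSatakeWeight, MonoidHom.comp_apply, ← symplecticSatakeWeight_ofAdd]
  rfl

/-! ## §3 The Satake transform of `ℋ(GSp(J, K), GSp(J, 𝒪))` -/

section Satake

variable [Valued K ℤᵐ⁰] {ϖ : K} [NeZero n]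

/-- **THE SATAKE TRANSFORM `𝒮 : ℋ(GSp_{2n}(K), GSp_{2n}(𝒪)) →ₐ[R] R[ℤⁿ × ℤ]`** of the spherical Hecke algebra of the group of
symplectic similitudes over a discretely valued field, `𝒮(T) = Σ_{γ ∈ G/K₀} (T [K₀])(γ) q^{⟨ρ, a(γ)⟩} x^{(a, c)(γ)}` — Andrianov–
Zhuravlev's spherical map `Ω` (triangular representatives, diagonal exponents, multiplier exponent), Cartier's
`δ^{1/2} ∫_N f(mn) dn` up to the integral twist `|r|^{-n(n+1)/4}`.  AN ALGEBRA HOMOMORPHISM (the `GSp` instance of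
`IsIwasawaExponent.satakeTransform`); the isomorphism onto the `W`-invariants (A–Z Thm. 3.30) is NOT claimed.
[cite: AndrianovZhuravlev1995, Ch. 3 §3.3 (3.44)–(3.49)] [cite: CartierCorvallis1979, §IV (4.2), Thm. 4.1] -/
def similitudeSatakeTransform (hϖ : Valued.v ϖ = WithZero.exp (-1 : ℤ)) (q : Rˣ) :
    heckeAlgebra R (symplecticSimilitudeGroup (Fin n) K) (symplecticSimilitudeInt (Fin n) K) →ₐ[R]
      AddMonoidAlgebra R ((Fin n → ℤ) × ℤ) :=
  (isIwasawaExponent_similitude hϖ).satakeTransform (similitudeSatakeWeight q)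

/-- Unfolding: `𝒮` is `IsIwasawaExponent.satakeTransform` of the `GSp` datum with weight `q^{⟨ρ, ·⟩}`.
[cite: CartierCorvallis1979, §IV (4.2)] -/
theorem similitudeSatakeTransform_eq (hϖ : Valued.v ϖ = WithZero.exp (-1 : ℤ)) (q : Rˣ) :
    similitudeSatakeTransform (n := n) hϖ q = (isIwasawaExponent_similitude hϖ).satakeTransform (similitudeSatakeWeight q) :=
  rfl

/-- `𝒮(T) = satakeVec (T [K₀])`. [cite: CartierCorvallis1979, §IV (4.2)] -/
theorem similitudeSatakeTransform_apply (hϖ : Valued.v ϖ = WithZero.exp (-1 : ℤ)) (q : Rˣ)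
    (T : heckeAlgebra R (symplecticSimilitudeGroup (Fin n) K) (symplecticSimilitudeInt (Fin n) K)) :
    similitudeSatakeTransform hϖ q T = IsIwasawaExponent.satakeVec (symplecticSimilitudeInt (Fin n) K)
      (similitudeIwasawaExp hϖ) (similitudeSatakeWeight q) (heckeAlgebra.toVector (symplecticSimilitudeInt (Fin n) K) T) :=
  rfl

/-- `𝒮` is multiplicative (an algebra homomorphism). [cite: AndrianovZhuravlev1995, Ch. 3 §3.3] [cite: CartierCorvallis1979, §IV Thm. 4.1] -/
theorem similitudeSatakeTransform_mul (hϖ : Valued.v ϖ = WithZero.exp (-1 : ℤ)) (q : Rˣ)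
    (S T : heckeAlgebra R (symplecticSimilitudeGroup (Fin n) K) (symplecticSimilitudeInt (Fin n) K)) :
    similitudeSatakeTransform hϖ q (S * T) = similitudeSatakeTransform hϖ q S * similitudeSatakeTransform hϖ q T :=
  map_mul _ S T

/-- **Every normalisation is a twist of the counting transform**: `𝒮_q = monomialTwist (q^{⟨ρ,·⟩}) ∘ 𝒮_1`.
[cite: CartierCorvallis1979, §IV (4.2)] -/
theorem similitudeSatakeTransform_eq_monomialTwist_comp (hϖ : Valued.v ϖ = WithZero.exp (-1 : ℤ)) (q : Rˣ) :
    similitudeSatakeTransform (n := n) hϖ q =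
      (monomialTwist (similitudeSatakeWeight q)).comp ((isIwasawaExponent_similitude hϖ).satakeTransform 1) :=
  (isIwasawaExponent_similitude hϖ).satakeTransform_eq_monomialTwist_comp _

variable [IsHeckeTriple (⊤ : Submonoid (symplecticSimilitudeGroup (Fin n) K)) (symplecticSimilitudeInt (Fin n) K)
  (symplecticSimilitudeInt (Fin n) K)]

/-- **`𝒮(T_g) = Σ_{α ∈ K₀gK₀/K₀} q^{⟨ρ, a(α)⟩} x^{(a, c)(α)}`** for the double-coset operator `T_g = [K₀ g K₀]` — the left-coset
expansion of A–Z (3.44). [cite: AndrianovZhuravlev1995, Ch. 3 §3.3 (3.44)] [cite: CartierCorvallis1979, §IV (4.2)] -/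
theorem similitudeSatakeTransform_doubleCosetOperator (hϖ : Valued.v ϖ = WithZero.exp (-1 : ℤ)) (q : Rˣ)
    (g : symplecticSimilitudeGroup (Fin n) K) :
    similitudeSatakeTransform hϖ q (heckeAlgebra.doubleCosetOperator (symplecticSimilitudeInt (Fin n) K) g) =
      ∑ α ∈ (finite_orbit_quotient (symplecticSimilitudeInt (Fin n) K) g).toFinset,
        AddMonoidAlgebra.single (similitudeIwasawaExp hϖ α.out)
          ((q ^ symplecticRhoPairing (similitudeIwasawaExp hϖ α.out).1 : Rˣ) : R) := by
  rw [similitudeSatakeTransform_eq, IsIwasawaExponent.satakeTransform_doubleCosetOperator]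
  exact Finset.sum_congr rfl fun α _ => by rw [similitudeSatakeWeight_ofAdd]

/-- **Coefficient formula**: the coefficient of `x^μ` in `𝒮(T_g)` is `#{α ∈ K₀gK₀/K₀ : (a, c)(α) = μ} · q^{⟨ρ, μ.1⟩}`.
[cite: AndrianovZhuravlev1995, Ch. 3 §3.3 (3.44)] -/
theorem coeff_similitudeSatakeTransform_doubleCosetOperator (hϖ : Valued.v ϖ = WithZero.exp (-1 : ℤ)) (q : Rˣ)
    (g : symplecticSimilitudeGroup (Fin n) K) (μ : (Fin n → ℤ) × ℤ)
    [DecidablePred fun α : symplecticSimilitudeGroup (Fin n) K ⧸ symplecticSimilitudeInt (Fin n) K =>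
      similitudeIwasawaExp hϖ α.out = μ] :
    (similitudeSatakeTransform hϖ q (heckeAlgebra.doubleCosetOperator (symplecticSimilitudeInt (Fin n) K) g)).coeff μ =
      (((finite_orbit_quotient (symplecticSimilitudeInt (Fin n) K) g).toFinset.filter
          fun α => similitudeIwasawaExp hϖ α.out = μ).card : R) * ((q ^ symplecticRhoPairing μ.1 : Rˣ) : R) := by
  rw [similitudeSatakeTransform_eq, IsIwasawaExponent.coeff_satakeTransform_doubleCosetOperator, similitudeSatakeWeight_ofAdd]

/-! ## §4 Unramified Hecke eigencharacters of `GSp(J, K)` -/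

omit [IsHeckeTriple (⊤ : Submonoid (symplecticSimilitudeGroup (Fin n) K)) (symplecticSimilitudeInt (Fin n) K)
  (symplecticSimilitudeInt (Fin n) K)] in
/-- **The unramified Hecke eigencharacter with torus parameter `χ`** (`χ : Multiplicative (ℤⁿ × ℤ) →* R`, i.e. values
`x₀ ↦ β₀`, `xᵢ ↦ βᵢ`): `λ_χ = ev_χ ∘ 𝒮 : ℋ(GSp(J, K), GSp(J, 𝒪)) →ₐ[R] R` — the homomorphisms `L_p → ℂ` parametrised by
A–Z Prop. 3.36 through `Ω`. [cite: AndrianovZhuravlev1995, Ch. 3 §3.3 Prop. 3.36] [cite: CartierCorvallis1979, §IV (4.2)–(4.4)] -/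
def similitudeHeckeEigencharacter (hϖ : Valued.v ϖ = WithZero.exp (-1 : ℤ)) (q : Rˣ)
    (χ : Multiplicative ((Fin n → ℤ) × ℤ) →* R) :
    heckeAlgebra R (symplecticSimilitudeGroup (Fin n) K) (symplecticSimilitudeInt (Fin n) K) →ₐ[R] R :=
  (isIwasawaExponent_similitude hϖ).heckeEigencharacter (similitudeSatakeWeight q) χ

omit [IsHeckeTriple (⊤ : Submonoid (symplecticSimilitudeGroup (Fin n) K)) (symplecticSimilitudeInt (Fin n) K)
  (symplecticSimilitudeInt (Fin n) K)] in
/-- `λ_χ` is multiplicative. [cite: CartierCorvallis1979, §IV (4.2)–(4.4)] -/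
theorem similitudeHeckeEigencharacter_mul (hϖ : Valued.v ϖ = WithZero.exp (-1 : ℤ)) (q : Rˣ)
    (χ : Multiplicative ((Fin n → ℤ) × ℤ) →* R)
    (S T : heckeAlgebra R (symplecticSimilitudeGroup (Fin n) K) (symplecticSimilitudeInt (Fin n) K)) :
    similitudeHeckeEigencharacter hϖ q χ (S * T) =
      similitudeHeckeEigencharacter hϖ q χ S * similitudeHeckeEigencharacter hϖ q χ T :=
  map_mul _ S T

omit [IsHeckeTriple (⊤ : Submonoid (symplecticSimilitudeGroup (Fin n) K)) (symplecticSimilitudeInt (Fin n) K)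
  (symplecticSimilitudeInt (Fin n) K)] in
/-- **The weight is absorbed in the parameter**: `λ^{q}_χ = λ^{1}_{q^{⟨ρ,·⟩} χ}`. [cite: CartierCorvallis1979, §IV (4.2)–(4.4)] -/
theorem similitudeHeckeEigencharacter_eq_one_mul (hϖ : Valued.v ϖ = WithZero.exp (-1 : ℤ)) (q : Rˣ)
    (χ : Multiplicative ((Fin n → ℤ) × ℤ) →* R) :
    similitudeHeckeEigencharacter (n := n) hϖ q χ =
      (isIwasawaExponent_similitude hϖ).heckeEigencharacter 1 (similitudeSatakeWeight q * χ) :=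
  (isIwasawaExponent_similitude hϖ).heckeEigencharacter_eq_one_mul _ _

/-- **The eigenvalue of `T_g`**: `λ_χ(T_g) = Σ_{α ∈ K₀gK₀/K₀} q^{⟨ρ, a(α)⟩} χ((a, c)(α))`. [cite: CartierCorvallis1979, §IV (4.2)]
[cite: AndrianovZhuravlev1995, Ch. 3 §3.3 (3.44)] -/
theorem similitudeHeckeEigencharacter_doubleCosetOperator (hϖ : Valued.v ϖ = WithZero.exp (-1 : ℤ)) (q : Rˣ)
    (χ : Multiplicative ((Fin n → ℤ) × ℤ) →* R) (g : symplecticSimilitudeGroup (Fin n) K) :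
    similitudeHeckeEigencharacter hϖ q χ (heckeAlgebra.doubleCosetOperator (symplecticSimilitudeInt (Fin n) K) g) =
      ∑ α ∈ (finite_orbit_quotient (symplecticSimilitudeInt (Fin n) K) g).toFinset,
        ((q ^ symplecticRhoPairing (similitudeIwasawaExp hϖ α.out).1 : Rˣ) : R) *
          χ (Multiplicative.ofAdd (similitudeIwasawaExp hϖ α.out)) := by
  rw [similitudeHeckeEigencharacter, IsIwasawaExponent.heckeEigencharacter_doubleCosetOperator]
  exact Finset.sum_congr rfl fun α _ => by rw [similitudeSatakeWeight_ofAdd]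

/-- **The degree character**: at `q = 1`, `χ = 1` the eigenvalue of `T_g` is the degree `#(K₀gK₀/K₀)`.
[cite: CartierCorvallis1979, §IV (4.2)] -/
theorem similitudeHeckeEigencharacter_one_one_doubleCosetOperator (hϖ : Valued.v ϖ = WithZero.exp (-1 : ℤ))
    (g : symplecticSimilitudeGroup (Fin n) K) :
    similitudeHeckeEigencharacter (R := R) hϖ 1 1 (heckeAlgebra.doubleCosetOperator (symplecticSimilitudeInt (Fin n) K) g) =
      ((finite_orbit_quotient (symplecticSimilitudeInt (Fin n) K) g).toFinset.card : R) := by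
  rw [similitudeHeckeEigencharacter_doubleCosetOperator]
  simp

end Satake

end Literature.NumberTheory.Automorphic.SymplecticCartan

end
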